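import Literature.NumberTheory.Automorphic.EichlerShimuraWeightTwoGammaSurjective
import Literature.NumberTheory.ModularForms.CongruenceSubgroupsNeat
import HarnessLib

/-!
# (ESᶜ-surj-Γ(M)) is a theorem: Eichler–Shimura surjectivity for `Γ(M)`, `M ≥ 3` (Shimura Thm. 8.4)

Topic `NumberTheory/Automorphic`; THEOREMS ONLY; two-line sequel of `EichlerShimuraWeightTwoGammaSurjective`
(`exists_cuspForm_rePeriod_eq`: Shimura Thm. 8.4 surjectivity at `n = 0` for every finite-index `Γ ≤ SL₂(ℤ)` acting freely on
`ℍ`, by the dimension count on the compact Riemann surface `X(Γ)` of `Literature/NumberTheory/ModularForms/ModularCurve*`), kept in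
its own file for the import of `ModularForms/CongruenceSubgroupsNeat` (Minkowski: `Γ(M)`, `M ≥ 3`, is torsion-free).

* `isCancelSMul_Gamma` — `Γ(M)`, `M ≥ 3`, acts freely on `ℍ`;
* ★ `eichlerShimura_weightTwo_rePeriod_surjective_Gamma_holds` — the named fact (ESᶜ-surj-Γ(M))
  `eichlerShimura_weightTwo_rePeriod_surjective_Gamma` of `FuchsianEichlerShimuraWeightTwo.lean` (G. Shimura, *Introduction to the
  arithmetic theory of automorphic functions* (1971), Thm. 8.4 p. 234 at `n = 0`, `Ψ = 1`, `Γ = Γ(M)`) IS A THEOREM.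

HONEST FRAMING. This discharges one print conjunct of the cite stub of crux `stmt-BirchSwinnertonDyer-24801` (with the tree's
reduction `EichlerShimuraCongruence.eichlerShimura_weightTwo_rePeriod_of_surjective_Gamma`, the whole of (ESᶜ)); nothing about NUM or
any curve is proved and BSD is proved for no curve.

## References

* G. Shimura, *Introduction to the arithmetic theory of automorphic functions* (1971), Thm. 8.4 p. 234. [ShimuraIATAF1971]
* F. Diamond, J. Shurman, *A first course in modular forms*, GTM 228 (2005), §2.3 Exercise 2.3.7. [DiamondShurman2005]
-/

noncomputable section

open scoped MatrixGroups
open Literature.NumberTheory.ModularForms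

namespace Literature.NumberTheory.Automorphic

/-- **`Γ(M)`, `M ≥ 3`, acts freely on `ℍ`** (Minkowski: `Γ(M)` is torsion-free, tree `Gamma.eq_one_of_isOfFinOrder`).
[cite: DiamondShurman2005, §2.3 Exercise 2.3.7] -/
theorem isCancelSMul_Gamma {M : ℕ} (hM : 3 ≤ M) :
    haveI : NeZero M := ⟨by omega⟩
    IsCancelSMul (CongruenceSubgroup.Gamma M : Subgroup (GL (Fin 2) ℝ)) UpperHalfPlane := by
  haveI : NeZero M := ⟨by omega⟩
  exact isCancelSMul_of_forall_isOfFinOrder _ fun γ hγ hfo => Gamma.eq_one_of_isOfFinOrder hM hγ hfo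

/-! ### The named fact (ESᶜ-surj-Γ(M)) is a theorem -/

/-- ★ **(ESᶜ-surj-Γ(M)) IS A THEOREM**: Shimura Thm. 8.4 surjectivity at `n = 0` for every principal congruence subgroup
`Γ(M)`, `M ≥ 3` — the named fact `eichlerShimura_weightTwo_rePeriod_surjective_Gamma` of `FuchsianEichlerShimuraWeightTwo.lean`
discharged on the compactified modular curve `X(M)`. [cite: ShimuraIATAF1971, Thm. 8.4 p. 234] -/
theorem eichlerShimura_weightTwo_rePeriod_surjective_Gamma_holds : eichlerShimura_weightTwo_rePeriod_surjective_Gamma := by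
  intro M hM z₀ u hu hpar
  haveI : NeZero M := ⟨by omega⟩
  haveI := isCancelSMul_Gamma hM
  exact exists_cuspForm_rePeriod_eq (CongruenceSubgroup.Gamma M) z₀ u hu hpar

end Literature.NumberTheory.Automorphic

end
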